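import Summits.Ventures.CertifiedManyBodySolver.Downfold.PinnedPairTPrimeOfQuotChainKernelCertsBox
import Summits.Ventures.CertifiedManyBodySolver.Rows.CARPolyWindowGramTBRows
import HarnessLib

/-!
# PINNED `t′`-PAIR nodes‴ (WN shapes) — THE «ROWS + HALVING» INPUT SHAPE (design of record for W3, captain R-g4-5): wide consumers with an
# anti-Hermitian Gram remainder (`…GX_wide`), their BOX editions over `gramTBRowsHalf` with kernel-computed eom masks (`…TBRowsHalfAuto_box`), and the
# M2(c) leaf closer in that shape

Venture CertifiedManyBodySolver; cell `hubbard-obs` / D-0154 (1)(C) COVERAGE La₂CuO₄; seat `hubbard-cov-la214-box-2` (g4), WN-twin desk; captain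
hubbard-cov-la214-plan-1 g4 R-g4-5 (hubbard-obs STATUS 2026-08-29T01:07:34Z: «the WN GX/RowsHalf box twin is box-2's pen … type-and-hold at idle allowed,
count-neutral»). One-writer rulings respected: the half-row Gram (`gramTBRowsHalf`, `lowerTB`, `termOp_flatten_gramTBRowsHalf`), the absorption identity
`termOp_residTG_gramX` and the single-vertex closers `…GX{Near,Auto}` / `…TBRowsHalfAuto` are hubbard-obs-p2's (`Rows/CARPolyWindowGramTBRows.lean`, p684213);
`autoMasks` / `eomFarOK_autoMasks` are hubbard-obs-p2's (`Rows/CorrWindowCertKernelEomAuto.lean`, p683122); the T-pair twins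
(`SquareTTPrimePinnedPairRowT.of_quotAdjChainNearKernelCertsGX{,Auto}_wide`, `…GXAuto_box`, `…TBRowsHalfAuto_box`, `…TBRowsAuto_box`) are hubbard-cov-la214-unc-2 g8's;
the box facts are unc-2's p682106 / hubbard-obs-p2's p677965 / p680316. THIS file = the WN / objective-family twins BY IMPORT, written against the tree only.

WHY: under (N)-BY-ROWS + ADJOINT HALVING the chain's Gram slices `gramTBRowsHalf K blocks` (products ÷2) denote the two-level Gram only up to an
anti-Hermitian remainder (`termOp_flatten_gramTBRowsHalf`); hubbard-obs-p2's `termOp_residTG_gramX` moves the remainder generator `V` into the anti-Hermitian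
family, so the WN pair entries of record (`…of_residPolys_wide`, p678809) apply verbatim with Gram `TGf` and family `(AV ++ allAdj …) ++ [V]`.

* §1 `TPrimePinnedPairFamilyRowWN.of_quotAdjChainNearKernelCertsGX_wide` — W3 §1's binder list with, per vertex, the Gram slots `TGs TGf V hΛm O hTGf hG`
  (`hTGf : termOp d TGf = gramForm Λm O`, `hG : termOp d TGs.flatten = termOp d TGf − termOp d V + (termOp d V)ᴴ`) in place of `TGs hΛm O hG`; explicit eom masks.
  Proof per vertex = W3's four lines (`allMovesZ_ok` ⇒ `shiftSet_subset_of_ok` ⇒ `d_gq_of_moves` ⇒ `evalPoly_quotAdjChainNear_residTG`, the family file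
  p679093) + ONE `rw [termOp_residTG_gramX …]`, then `…of_residPolys_wide`.
* §2 `TPrimePinnedPair{Family,}RowWN.of_quotAdjChainKernelCertsTBRowsHalfAuto_box (r R vmax) (7 ≤ R) (r+1 ≤ R) (r+vmax ≤ R) …` — THE INSTANCE-FACING WN
  THEOREMS FOR THE DESIGN OF RECORD: box geometry discharged as in p682425; per vertex ONLY `TH hH TE hE TX hX μ ν κ cap κ' fl K blocks CW hcw AV ns M Cs hC0 Hs
  hchain hβ hsl` — NO `hΛm`, NO `hTG`, NO masks, NO `hfar` (`TGs := gramTBRowsHalf K blocks`, `masks := autoMasks TH (boxPush r R) EB`, PSD-ness / remainder /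
  far check discharged inside by `gramTBCoef_posSemidef` / `termOp_gramTB_eq_gramForm` / `termOp_flatten_gramTBRowsHalf` / `eomFarOK_autoMasks`).
* §3 `La214M2c_StiffnessBoxCeiling_of_quotAdjChainKernelTBRowsHalfAutoPairs_box` — the M2(c) «LSCO x = 1/8» leaf from a `Po` box pair + an `Oi` box pair in
  the §2 shape + FILE D's decidable row block (p670727) via `La214M2c_StiffnessBoxCeiling_of_pairRows` (p674101).

EFFECT: an M2(c) / WN / NdNiO₂-shape / Hg-K2-bottom pair instance emitted under R-g4-5 composes with NO further Lean (per vertex residue: the chain `ns M Cs hC0 Hs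
hchain`, the blocks `K blocks`, the rows `μ ν κ cap κ' fl`, `CW hcw AV`, ONE inequality, the slope). Instantiated by NO certificate (no M2(c) chain exists; the M2(c)
tier-P edition is a director decision — interface typing, not a forecast). Edition of record UNCHANGED (`…_cQ` p660755; box word 0.4001659, margin 0.0015674).
HONEST FRAMING: Lean plumbing; evaluates nothing, discharges NO node; no number of record / tier / hold / box word / registry row changes; CONTROL / CALIBRATION
class (wording (xx1)); a ceiling never speaks to the presence of superconductivity or to `ρ_s = 0`; no `T_c` / phase sentence; nothing about La₁.₈₇₅Sr₀.₁₂₅CuO₄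
samples; no item (K1/K2 untouched), rung leaf (M2(c) has no route) or summit statement is proved here. Zero compute.

References: X. Han, arXiv:2006.06002, §3 [cite: Han2020Bootstrap, §3]; J. Wang et al., PRX 14 (2024) 031006, §III [cite: WangEtAl2024, §III]; C. Jansson, D. Chaykin, C. Keil,
SIAM J. Numer. Anal. 46 (2008) 180, §3 [cite: JanssonChaykinKeil2008, §3]; O. Bratteli, D. W. Robinson, *OAQSM 2*, §5.2.2 [cite: BratteliRobinsonII1997, §5.2.2]; [cite: KomaTasaki1994, §1].
-/

noncomputable section

namespace Summit.Ventures.CertifiedManyBodySolver.Downfold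

open Literature.MathematicalPhysics.QuantumLattice
open Matrix HubbardWave0 Literature.Probability.LatticeModels ThermodynamicLimit Filter Topology
open Literature.MathematicalPhysics.QuantumManyBody.StateRelaxation
open Summit.Ventures.CertifiedQuantumChemistry Summit.Ventures.CertifiedQuantumChemistry.CARPoly
open Summit.Ventures.CertifiedManyBodySolver.CARPolyWindow Summit.Ventures.CertifiedManyBodySolver.CARPolyWindow.BoxGeom
open Summit.Ventures.CertifiedManyBodySolver.Observables
open scoped BigOperators ComplexOrder

/-! ## §1 The wide WN-family consumer with an anti-Hermitian Gram remainder (explicit eom masks) -/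

section GXWide

variable {N Nβ : ℕ} [NeZero N]

/-- **WN-FAMILY PAIR NODE‴ FROM TWO `stepEQA` CHAINS WHOSE GRAM SLICES DENOTE `G − V + Vᴴ`** (wide window `Λ' ⊇ box 2 7`, explicit eom masks; per vertex the chain
slices `TGs_v`, a named term `TGf_v` denoting a PSD `gramForm Λm_v O_v`, and a remainder generator `V_v` with
`hG_v : termOp d TGs_v.flatten = termOp d TGf_v − termOp d V_v + (termOp d V_v)ᴴ`; everything else as
`TPrimePinnedPairFamilyRowWN.of_quotAdjChainNearKernelCerts_wide`) ⟹ the family pair row. [cite: Han2020Bootstrap, §3] [cite: WangEtAl2024, §III]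
[cite: JanssonChaykinKeil2008, §3] [cite: BratteliRobinsonII1997, §5.2.2] -/
theorem TPrimePinnedPairFamilyRowWN.of_quotAdjChainNearKernelCertsGX_wide
    (U : ℚ) (hU : 0 ≤ U) (n₀ sA sB : ℚ)
    {Λ Λ' : Finset (Site 2)} (h7 : Literature.Probability.LatticeModels.box 2 7 ⊆ Λ') (hΛ : Λ ⊆ Λ') (h8 : thicken Λ 1 ⊆ Λ')
    (h0 : thicken ({0} : Finset (Site 2)) 1 ⊆ Λ') (hz : (0 : Site 2) ∈ Λ')
    (D : QuotData N Nβ) (hxs : ∀ i, D.xs i ∈ Λ') (hix : ∀ y ∈ Λ', D.xs (D.ix y) = y)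
    (hxsβ : ∀ j, D.xsβ j ∈ Λ) (hcovβ : ∀ x ∈ Λ, ∃ j, D.xsβ j = x)
    (d : Orb (Fin N) → Orb (PolySite Λ')) (hd : Function.Injective d)
    (hdx : ∀ i σ, d (orb i σ) = orb (PolySite.pt (D.xs i) (hxs i)) σ) (Bkey : ℕ)
    (dΛ : Orb (Fin Nβ) → Orb (PolySite Λ)) (hdΛ : ∀ j σ, dΛ (orb j σ) = orb (PolySite.pt (D.xsβ j) (hxsβ j)) σ)
    (hf : ∀ b, d (D.f b) = Orb.embMap (PolySite.incl hΛ) (dΛ b))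
    (sp : Orb (Fin N) → Fin 2) (hsp : ∀ a, (ofLex (d a)).2 = sp a)
    (hokV : ∀ γc v, D.ok γc v = true →
      ∀ j : Fin Nβ, D.xs (D.ix (d4Vec (d4OfCode γc) (D.xsβ j) + siteOfPair v)) = d4Vec (d4OfCode γc) (D.xsβ j) + siteOfPair v)
    (o : Fin 2 → Orb (Fin N)) (ho : ∀ σ, d (o σ) = orb (PolySite.pt 0 hz) σ)
    (X : ℝ → FermionOp (Literature.Probability.LatticeModels.box 2 7)) (EB : List (Terms (Orb (Fin Nβ))))
    -- vertex A
    (THA : Terms (Orb (Fin N)))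
    (hHA : termOp d THA = (hubbardTTPrimeFermionInteraction 1 (sA : ℝ) (U : ℝ)).localHamiltonian Λ')
    (TEA : Terms (Orb (Fin N)))
    (hEA : termOp d TEA = fermionEmbed (PolySite.incl h0) ((hubbardTTPrimeFermionInteraction 1 (sA : ℝ) (U : ℝ)).meanEnergyObs 1))
    (TXA : Terms (Orb (Fin N))) (hXA : termOp d TXA = fermionEmbed (PolySite.incl h7) (X (sA : ℝ))) (μA : Fin 2 → ℚ) (νA κA capA κA' flA : ℚ)
    (TGsA : List (Terms (Orb (Fin N)))) (TGfA VA : Terms (Orb (Fin N)))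
    {mA : Type*} [Fintype mA] [DecidableEq mA] {ΛmA : Matrix mA mA ℂ} (hΛmA : ΛmA.PosSemidef)
    (OA : mA → FermionOp Λ') (hTGfA : termOp d TGfA = gramForm ΛmA OA)
    (hGA : termOp d TGsA.flatten = termOp d TGfA - termOp d VA + (termOp d VA)ᴴ)
    (CWA : Terms (Orb (Fin N))) (hcwA : ∀ wc ∈ CWA, chargeW wc.1 ≠ 0 ∨ spinChargeW sp wc.1 ≠ 0) (AVA : List (Terms (Orb (Fin N))))
    (masksA : List (List Bool)) (hfarA : eomFarOK THA D.f EB masksA = true)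
    (nsA : List ℕ) (MA : ℕ) (CsA : List SOSDual.EncPoly) (hC0A : CsA.getD 0 [] = []) (HsA : List (List (QHint Nβ)))
    (hchainA : ChainQAOK D Bkey MA CsA
      (groupSlices (residTGslicesNear TXA μA νA o κA capA κA' flA TEA TGsA THA D.f EB masksA
        (fun l : Fin 0 => l.elim0) (fun l : Fin 0 => l.elim0) CWA AVA) nsA) HsA)
    {βA : ℚ} (hβA : βA ≤ lowerConst (SOSDual.decPoly N (CsA.getD MA [])) + (μA 0 + μA 1) * (n₀ / 2 - νA))
    {slA : ℚ} (hslA : slA = (μA 0 + μA 1) / 2)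
    -- vertex B
    (THB : Terms (Orb (Fin N)))
    (hHB : termOp d THB = (hubbardTTPrimeFermionInteraction 1 (sB : ℝ) (U : ℝ)).localHamiltonian Λ')
    (TEB : Terms (Orb (Fin N)))
    (hEB : termOp d TEB = fermionEmbed (PolySite.incl h0) ((hubbardTTPrimeFermionInteraction 1 (sB : ℝ) (U : ℝ)).meanEnergyObs 1))
    (TXB : Terms (Orb (Fin N))) (hXB : termOp d TXB = fermionEmbed (PolySite.incl h7) (X (sB : ℝ))) (μB : Fin 2 → ℚ) (νB κB capB κB' flB : ℚ)
    (TGsB : List (Terms (Orb (Fin N)))) (TGfB VB : Terms (Orb (Fin N)))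
    {mB : Type*} [Fintype mB] [DecidableEq mB] {ΛmB : Matrix mB mB ℂ} (hΛmB : ΛmB.PosSemidef)
    (OB : mB → FermionOp Λ') (hTGfB : termOp d TGfB = gramForm ΛmB OB)
    (hGB : termOp d TGsB.flatten = termOp d TGfB - termOp d VB + (termOp d VB)ᴴ)
    (CWB : Terms (Orb (Fin N))) (hcwB : ∀ wc ∈ CWB, chargeW wc.1 ≠ 0 ∨ spinChargeW sp wc.1 ≠ 0) (AVB : List (Terms (Orb (Fin N))))
    (masksB : List (List Bool)) (hfarB : eomFarOK THB D.f EB masksB = true)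
    (nsB : List ℕ) (MB : ℕ) (CsB : List SOSDual.EncPoly) (hC0B : CsB.getD 0 [] = []) (HsB : List (List (QHint Nβ)))
    (hchainB : ChainQAOK D Bkey MB CsB
      (groupSlices (residTGslicesNear TXB μB νB o κB capB κB' flB TEB TGsB THB D.f EB masksB
        (fun l : Fin 0 => l.elim0) (fun l : Fin 0 => l.elim0) CWB AVB) nsB) HsB)
    {βB : ℚ} (hβB : βB ≤ lowerConst (SOSDual.decPoly N (CsB.getD MB [])) + (μB 0 + μB 1) * (n₀ / 2 - νB))
    {slB : ℚ} (hslB : slB = (μB 0 + μB 1) / 2) :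
    TPrimePinnedPairFamilyRowWN (U : ℝ) (sA : ℝ) (sB : ℝ) capA capB flA flB βA κA κA' slA βB κB κB' slB n₀ X := by
  -- the accepted move lists of the two chains
  set LA := allMovesZ D Bkey (groupSlices (residTGslicesNear TXA μA νA o κA capA κA' flA TEA TGsA THA D.f EB masksA
    (fun l : Fin 0 => l.elim0) (fun l : Fin 0 => l.elim0) CWA AVA) nsA) HsA MA with hLA
  set LB := allMovesZ D Bkey (groupSlices (residTGslicesNear TXB μB νB o κB capB κB' flB TEB TGsB THB D.f EB masksB
    (fun l : Fin 0 => l.elim0) (fun l : Fin 0 => l.elim0) CWB AVB) nsB) HsB MB with hLB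
  -- every accepted move is licensed ⇒ geometry of the rebuilt families from the tables
  have hokA : ∀ mv ∈ LA, D.ok mv.1 mv.2.1 = true := allMovesZ_ok D Bkey _ HsA MA
  have hokB : ∀ mv ∈ LB, D.ok mv.1 mv.2.1 = true := allMovesZ_ok D Bkey _ HsB MB
  have hshA : ∀ l : Fin LA.length, d4ShiftSet (d4OfCode (LA.get l).1) (siteOfPair (LA.get l).2.1) Λ ⊆ Λ' :=
    shiftSet_subset_of_ok D hxs hcovβ hokV LA hokA
  have hshB : ∀ l : Fin LB.length, d4ShiftSet (d4OfCode (LB.get l).1) (siteOfPair (LB.get l).2.1) Λ ⊆ Λ' :=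
    shiftSet_subset_of_ok D hxs hcovβ hokV LB hokB
  have hgA := d_gq_of_moves D hxs d hdx hix hxsβ dΛ hdΛ LA hshA
  have hgB := d_gq_of_moves D hxs d hdx hix hxsβ dΛ hdΛ LB hshB
  -- the SEMANTIC residuals WITH the accepted families …
  have hRA := evalPoly_quotAdjChainNear_residTG hd D Bkey TXA μA νA o κA capA κA' flA TEA TGsA THA EB masksA hfarA
    CWA AVA nsA MA CsA hC0A HsA hchainA LA hLA
  have hRB := evalPoly_quotAdjChainNear_residTG hd D Bkey TXB μB νB o κB capB κB' flB TEB TGsB THB EB masksB hfarB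
    CWB AVB nsB MB CsB hC0B HsB hchainB LB hLB
  -- … with the Gram remainders moved into the adjoint families (hubbard-obs-p2's `termOp_residTG_gramX`)
  rw [termOp_residTG_gramX d TXA μA νA o κA capA κA' flA TEA TGsA.flatten TGfA VA hGA THA D.f EB _ _ CWA _] at hRA
  rw [termOp_residTG_gramX d TXB μB νB o κB capB κB' flB TEB TGsB.flatten TGfB VB hGB THB D.f EB _ _ CWB _] at hRB
  exact TPrimePinnedPairFamilyRowWN.of_residPolys_wide U hU n₀ sA sB h7 hΛ h8 h0 hz d dΛ D.f hf sp hsp o ho X EB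
    THA hHA TEA hEA TXA hXA μA νA κA capA κA' flA TGfA hΛmA OA hTGfA _ _ hshA _ hgA _ CWA hcwA _ hRA hβA hslA
    THB hHB TEB hEB TXB hXB μB νB κB capB κB' flB TGfB hΛmB OB hTGfB _ _ hshB _ hgB _ CWB hcwB _ hRB hβB hslB

end GXWide

/-! ## §2 THE BOX EDITIONS over `gramTBRowsHalf` with kernel-computed eom masks — the instance-facing WN theorems for the design of record -/

section RowsHalfBox

/-- **WN-FAMILY PAIR NODE‴, «ROWS + HALVING» DESIGN OF RECORD, ON THE BOX GEOMETRY** — `D := boxQuot r R vmax`, `Λ := boxW r ⊆ Λ' := boxW R`, letters `boxD`,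
push `boxPush r R`, origin letters `orb (boxIx R 0) σ`; per vertex the chain runs over `residTGslicesNear … (gramTBRowsHalf K_v blocks_v) TH_v (boxPush r R) EB
(autoMasks TH_v (boxPush r R) EB) …`; PSD-ness of the two-level coefficient matrix, the anti-Hermitian remainder `lowerTB` and the eom far check are discharged
HERE (`gramTBCoef_posSemidef`, `termOp_gramTB_eq_gramForm`, `termOp_flatten_gramTBRowsHalf`, `eomFarOK_autoMasks`). Per vertex the instance supplies ONLY
`TH hH TE hE TX hX μ ν κ cap κ' fl K blocks CW hcw AV ns M Cs hC0 Hs hchain hβ hsl`. [cite: Han2020Bootstrap, §3] [cite: WangEtAl2024, §III]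
[cite: JanssonChaykinKeil2008, §3] -/
theorem TPrimePinnedPairFamilyRowWN.of_quotAdjChainKernelCertsTBRowsHalfAuto_box
    (r R vmax : ℕ) (h7R : 7 ≤ R) (hrR : r + 1 ≤ R) (hvR : r + vmax ≤ R)
    (U : ℚ) (hU : 0 ≤ U) (n₀ sA sB : ℚ) (Bkey : ℕ)
    (X : ℝ → FermionOp (Literature.Probability.LatticeModels.box 2 7)) (EB : List (Terms (Orb (Fin (boxN r)))))
    -- vertex A
    (THA : Terms (Orb (Fin (boxN R))))
    (hHA : termOp (boxD R) THA = (hubbardTTPrimeFermionInteraction 1 (sA : ℝ) (U : ℝ)).localHamiltonian (boxW R))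
    (TEA : Terms (Orb (Fin (boxN R))))
    (hEA : termOp (boxD R) TEA =
      fermionEmbed (PolySite.incl (thicken01_subset_boxW (le_trans (by norm_num) h7R)))
        ((hubbardTTPrimeFermionInteraction 1 (sA : ℝ) (U : ℝ)).meanEnergyObs 1))
    (TXA : Terms (Orb (Fin (boxN R)))) (hXA : termOp (boxD R) TXA = fermionEmbed (PolySite.incl (box_subset_boxW h7R)) (X (sA : ℝ)))
    (μA : Fin 2 → ℚ) (νA κA capA κA' flA : ℚ) (KA : ℕ) (blocksA : List (List (List ℤ × Terms (Orb (Fin (boxN R))))))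
    (CWA : Terms (Orb (Fin (boxN R)))) (hcwA : ∀ wc ∈ CWA, chargeW wc.1 ≠ 0 ∨ spinChargeW (fun a => (ofLex a).2) wc.1 ≠ 0)
    (AVA : List (Terms (Orb (Fin (boxN R)))))
    (nsA : List ℕ) (MA : ℕ) (CsA : List SOSDual.EncPoly) (hC0A : CsA.getD 0 [] = []) (HsA : List (List (QHint (boxN r))))
    (hchainA : ChainQAOK (boxQuot r R vmax) Bkey MA CsA
      (groupSlices (residTGslicesNear TXA μA νA (fun σ => orb (boxIx R 0) σ) κA capA κA' flA TEA (gramTBRowsHalf KA blocksA) THA (boxPush r R) EB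
        (autoMasks THA (boxPush r R) EB) (fun l : Fin 0 => l.elim0) (fun l : Fin 0 => l.elim0) CWA AVA) nsA) HsA)
    {βA : ℚ}
    (hβA : haveI := neZero_boxN R; βA ≤ lowerConst (SOSDual.decPoly (boxN R) (CsA.getD MA [])) + (μA 0 + μA 1) * (n₀ / 2 - νA))
    {slA : ℚ} (hslA : slA = (μA 0 + μA 1) / 2)
    -- vertex B
    (THB : Terms (Orb (Fin (boxN R))))
    (hHB : termOp (boxD R) THB = (hubbardTTPrimeFermionInteraction 1 (sB : ℝ) (U : ℝ)).localHamiltonian (boxW R))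
    (TEB : Terms (Orb (Fin (boxN R))))
    (hEB : termOp (boxD R) TEB =
      fermionEmbed (PolySite.incl (thicken01_subset_boxW (le_trans (by norm_num) h7R)))
        ((hubbardTTPrimeFermionInteraction 1 (sB : ℝ) (U : ℝ)).meanEnergyObs 1))
    (TXB : Terms (Orb (Fin (boxN R)))) (hXB : termOp (boxD R) TXB = fermionEmbed (PolySite.incl (box_subset_boxW h7R)) (X (sB : ℝ)))
    (μB : Fin 2 → ℚ) (νB κB capB κB' flB : ℚ) (KB : ℕ) (blocksB : List (List (List ℤ × Terms (Orb (Fin (boxN R))))))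
    (CWB : Terms (Orb (Fin (boxN R)))) (hcwB : ∀ wc ∈ CWB, chargeW wc.1 ≠ 0 ∨ spinChargeW (fun a => (ofLex a).2) wc.1 ≠ 0)
    (AVB : List (Terms (Orb (Fin (boxN R)))))
    (nsB : List ℕ) (MB : ℕ) (CsB : List SOSDual.EncPoly) (hC0B : CsB.getD 0 [] = []) (HsB : List (List (QHint (boxN r))))
    (hchainB : ChainQAOK (boxQuot r R vmax) Bkey MB CsB
      (groupSlices (residTGslicesNear TXB μB νB (fun σ => orb (boxIx R 0) σ) κB capB κB' flB TEB (gramTBRowsHalf KB blocksB) THB (boxPush r R) EB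
        (autoMasks THB (boxPush r R) EB) (fun l : Fin 0 => l.elim0) (fun l : Fin 0 => l.elim0) CWB AVB) nsB) HsB)
    {βB : ℚ}
    (hβB : haveI := neZero_boxN R; βB ≤ lowerConst (SOSDual.decPoly (boxN R) (CsB.getD MB [])) + (μB 0 + μB 1) * (n₀ / 2 - νB))
    {slB : ℚ} (hslB : slB = (μB 0 + μB 1) / 2) :
    TPrimePinnedPairFamilyRowWN (U : ℝ) (sA : ℝ) (sB : ℝ) capA capB flA flB βA κA κA' slA βB κB κB' slB n₀ X := by
  haveI : NeZero (boxN R) := neZero_boxN R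
  have hrR' : r ≤ R := by omega
  exact TPrimePinnedPairFamilyRowWN.of_quotAdjChainNearKernelCertsGX_wide U hU n₀ sA sB (box_subset_boxW h7R) (boxW_mono hrR')
    (thicken_boxW_subset_boxW hrR) (thicken01_subset_boxW (le_trans (by norm_num) h7R)) (zero_mem_boxW R)
    (boxQuot r R vmax) (boxXs_mem R) (fun y hy => boxXs_boxIx R y hy) (boxXs_mem r) (boxQuot_hcovβ r R vmax)
    (boxD R) (boxD_injective R) (boxD_orb R) Bkey (boxD r) (boxQuot_hdΛ r R vmax) (fun b => boxD_boxPush hrR' b)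
    (fun a => (ofLex a).2) (boxD_spin R) (fun γc v hok j => box_hokV hvR γc v hok j) (fun σ => orb (boxIx R 0) σ) (boxD_orb_boxIx_zero R) X EB
    THA hHA TEA hEA TXA hXA μA νA κA capA κA' flA (gramTBRowsHalf KA blocksA) (gramTB KA blocksA) (lowerTB KA blocksA)
    (gramTBCoef_posSemidef KA blocksA) (gramTBOp (boxD R) blocksA) (termOp_gramTB_eq_gramForm (boxD R) KA blocksA)
    (termOp_flatten_gramTBRowsHalf (boxD R) KA blocksA) CWA hcwA AVA (autoMasks THA (boxPush r R) EB) (eomFarOK_autoMasks THA (boxPush r R) EB)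
    nsA MA CsA hC0A HsA hchainA hβA hslA
    THB hHB TEB hEB TXB hXB μB νB κB capB κB' flB (gramTBRowsHalf KB blocksB) (gramTB KB blocksB) (lowerTB KB blocksB)
    (gramTBCoef_posSemidef KB blocksB) (gramTBOp (boxD R) blocksB) (termOp_gramTB_eq_gramForm (boxD R) KB blocksB)
    (termOp_flatten_gramTBRowsHalf (boxD R) KB blocksB) CWB hcwB AVB (autoMasks THB (boxPush r R) EB) (eomFarOK_autoMasks THB (boxPush r R) EB)
    nsB MB CsB hC0B HsB hchainB hβB hslB

/-- **CONSTANT-OBJECTIVE WN PAIR NODE‴, «ROWS + HALVING» DESIGN OF RECORD, ON THE BOX GEOMETRY** (`TPrimePinnedPairRowWN … X₀`; e.g. the M2(c) `Po` pair or a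
Hg-1201 K2 bottom pair with a corner word), via `TPrimePinnedPairRowWN_iff_family`. [cite: Han2020Bootstrap, §3] [cite: WangEtAl2024, §III] -/
theorem TPrimePinnedPairRowWN.of_quotAdjChainKernelCertsTBRowsHalfAuto_box
    (r R vmax : ℕ) (h7R : 7 ≤ R) (hrR : r + 1 ≤ R) (hvR : r + vmax ≤ R)
    (U : ℚ) (hU : 0 ≤ U) (n₀ sA sB : ℚ) (Bkey : ℕ)
    (X₀ : FermionOp (Literature.Probability.LatticeModels.box 2 7)) (EB : List (Terms (Orb (Fin (boxN r)))))
    -- vertex A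
    (THA : Terms (Orb (Fin (boxN R))))
    (hHA : termOp (boxD R) THA = (hubbardTTPrimeFermionInteraction 1 (sA : ℝ) (U : ℝ)).localHamiltonian (boxW R))
    (TEA : Terms (Orb (Fin (boxN R))))
    (hEA : termOp (boxD R) TEA =
      fermionEmbed (PolySite.incl (thicken01_subset_boxW (le_trans (by norm_num) h7R)))
        ((hubbardTTPrimeFermionInteraction 1 (sA : ℝ) (U : ℝ)).meanEnergyObs 1))
    (TXA : Terms (Orb (Fin (boxN R)))) (hXA : termOp (boxD R) TXA = fermionEmbed (PolySite.incl (box_subset_boxW h7R)) X₀)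
    (μA : Fin 2 → ℚ) (νA κA capA κA' flA : ℚ) (KA : ℕ) (blocksA : List (List (List ℤ × Terms (Orb (Fin (boxN R))))))
    (CWA : Terms (Orb (Fin (boxN R)))) (hcwA : ∀ wc ∈ CWA, chargeW wc.1 ≠ 0 ∨ spinChargeW (fun a => (ofLex a).2) wc.1 ≠ 0)
    (AVA : List (Terms (Orb (Fin (boxN R)))))
    (nsA : List ℕ) (MA : ℕ) (CsA : List SOSDual.EncPoly) (hC0A : CsA.getD 0 [] = []) (HsA : List (List (QHint (boxN r))))
    (hchainA : ChainQAOK (boxQuot r R vmax) Bkey MA CsA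
      (groupSlices (residTGslicesNear TXA μA νA (fun σ => orb (boxIx R 0) σ) κA capA κA' flA TEA (gramTBRowsHalf KA blocksA) THA (boxPush r R) EB
        (autoMasks THA (boxPush r R) EB) (fun l : Fin 0 => l.elim0) (fun l : Fin 0 => l.elim0) CWA AVA) nsA) HsA)
    {βA : ℚ}
    (hβA : haveI := neZero_boxN R; βA ≤ lowerConst (SOSDual.decPoly (boxN R) (CsA.getD MA [])) + (μA 0 + μA 1) * (n₀ / 2 - νA))
    {slA : ℚ} (hslA : slA = (μA 0 + μA 1) / 2)
    -- vertex B
    (THB : Terms (Orb (Fin (boxN R))))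
    (hHB : termOp (boxD R) THB = (hubbardTTPrimeFermionInteraction 1 (sB : ℝ) (U : ℝ)).localHamiltonian (boxW R))
    (TEB : Terms (Orb (Fin (boxN R))))
    (hEB : termOp (boxD R) TEB =
      fermionEmbed (PolySite.incl (thicken01_subset_boxW (le_trans (by norm_num) h7R)))
        ((hubbardTTPrimeFermionInteraction 1 (sB : ℝ) (U : ℝ)).meanEnergyObs 1))
    (TXB : Terms (Orb (Fin (boxN R)))) (hXB : termOp (boxD R) TXB = fermionEmbed (PolySite.incl (box_subset_boxW h7R)) X₀)
    (μB : Fin 2 → ℚ) (νB κB capB κB' flB : ℚ) (KB : ℕ) (blocksB : List (List (List ℤ × Terms (Orb (Fin (boxN R))))))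
    (CWB : Terms (Orb (Fin (boxN R)))) (hcwB : ∀ wc ∈ CWB, chargeW wc.1 ≠ 0 ∨ spinChargeW (fun a => (ofLex a).2) wc.1 ≠ 0)
    (AVB : List (Terms (Orb (Fin (boxN R)))))
    (nsB : List ℕ) (MB : ℕ) (CsB : List SOSDual.EncPoly) (hC0B : CsB.getD 0 [] = []) (HsB : List (List (QHint (boxN r))))
    (hchainB : ChainQAOK (boxQuot r R vmax) Bkey MB CsB
      (groupSlices (residTGslicesNear TXB μB νB (fun σ => orb (boxIx R 0) σ) κB capB κB' flB TEB (gramTBRowsHalf KB blocksB) THB (boxPush r R) EB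
        (autoMasks THB (boxPush r R) EB) (fun l : Fin 0 => l.elim0) (fun l : Fin 0 => l.elim0) CWB AVB) nsB) HsB)
    {βB : ℚ}
    (hβB : haveI := neZero_boxN R; βB ≤ lowerConst (SOSDual.decPoly (boxN R) (CsB.getD MB [])) + (μB 0 + μB 1) * (n₀ / 2 - νB))
    {slB : ℚ} (hslB : slB = (μB 0 + μB 1) / 2) :
    TPrimePinnedPairRowWN (U : ℝ) (sA : ℝ) (sB : ℝ) capA capB flA flB βA κA κA' slA βB κB κB' slB n₀ X₀ :=
  (TPrimePinnedPairRowWN_iff_family).2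
    (TPrimePinnedPairFamilyRowWN.of_quotAdjChainKernelCertsTBRowsHalfAuto_box r R vmax h7R hrR hvR U hU n₀ sA sB Bkey (fun _ => X₀) EB
      THA hHA TEA hEA TXA hXA μA νA κA capA κA' flA KA blocksA CWA hcwA AVA nsA MA CsA hC0A HsA hchainA hβA hslA
      THB hHB TEB hEB TXB hXB μB νB κB capB κB' flB KB blocksB CWB hcwB AVB nsB MB CsB hC0B HsB hchainB hβB hslB)

end RowsHalfBox

/-! ## §3 THE M2(c) LEAF FROM TWO «ROWS + HALVING» BOX PAIRS (`Po`, `Oi`) + FILE D's DECIDABLE ROW DATA -/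

section M2cRowsHalfCloser

/-- **`La214M2c_StiffnessBoxCeiling` ⇐ TWO «ROWS + HALVING» BOX PAIRS + DECIDABLE ROW DATA** — ONE geometry `(r R vmax)` and ONE `Bkey`; the `Po` pair (`oA` at
`t′ = −357/740`, `oB` at `−3/10`; corner word `−X₀(−3/10, 29/5)`; ONE `EBo`) and the `Oi` pair (`iA` at `−3/10`, `iB` at `−1/5`; own words; ONE `EBi`), each vertex =
§2 data at the station `(29/5, 7/8)` (chain over `gramTBRowsHalf K blocks` with `autoMasks`); then FILE D's row block verbatim ⟹ the leaf, via
`La214M2c_StiffnessBoxCeiling_of_pairRows`. [cite: WangEtAl2024, §III] [cite: Han2020Bootstrap, §3] [cite: KomaTasaki1994, §1] -/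
theorem La214M2c_StiffnessBoxCeiling_of_quotAdjChainKernelTBRowsHalfAutoPairs_box
    (r R vmax : ℕ) (h7R : 7 ≤ R) (hrR : r + 1 ≤ R) (hvR : r + vmax ≤ R) (Bkey : ℕ)
    -- ===== the `Po` pair =====
    (EBo : List (Terms (Orb (Fin (boxN r)))))
    (THoA : Terms (Orb (Fin (boxN R))))
    (hHoA : termOp (boxD R) THoA = (hubbardTTPrimeFermionInteraction 1 (((-(357 / 740) : ℚ)) : ℝ) (((29 / 5 : ℚ)) : ℝ)).localHamiltonian (boxW R))
    (TEoA : Terms (Orb (Fin (boxN R))))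
    (hEoA : termOp (boxD R) TEoA =
      fermionEmbed (PolySite.incl (thicken01_subset_boxW (le_trans (by norm_num) h7R)))
        ((hubbardTTPrimeFermionInteraction 1 (((-(357 / 740) : ℚ)) : ℝ) (((29 / 5 : ℚ)) : ℝ)).meanEnergyObs 1))
    (TXoA : Terms (Orb (Fin (boxN R))))
    (hXoA : termOp (boxD R) TXoA = fermionEmbed (PolySite.incl (box_subset_boxW h7R)) (-oddMomentObsTT (-3 / 10) (29 / 5) 0))
    (μoA : Fin 2 → ℚ) (νoA κoA capoA κoA' floA : ℚ) (KoA : ℕ) (blocksoA : List (List (List ℤ × Terms (Orb (Fin (boxN R))))))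
    (CWoA : Terms (Orb (Fin (boxN R)))) (hcwoA : ∀ wc ∈ CWoA, chargeW wc.1 ≠ 0 ∨ spinChargeW (fun a => (ofLex a).2) wc.1 ≠ 0)
    (AVoA : List (Terms (Orb (Fin (boxN R)))))
    (nsoA : List ℕ) (MoA : ℕ) (CsoA : List SOSDual.EncPoly) (hC0oA : CsoA.getD 0 [] = []) (HsoA : List (List (QHint (boxN r))))
    (hchainoA : ChainQAOK (boxQuot r R vmax) Bkey MoA CsoA
      (groupSlices (residTGslicesNear TXoA μoA νoA (fun σ => orb (boxIx R 0) σ) κoA capoA κoA' floA TEoA (gramTBRowsHalf KoA blocksoA) THoA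
        (boxPush r R) EBo (autoMasks THoA (boxPush r R) EBo) (fun l : Fin 0 => l.elim0) (fun l : Fin 0 => l.elim0) CWoA AVoA) nsoA) HsoA)
    {βoA : ℚ}
    (hβoA : haveI := neZero_boxN R; βoA ≤ lowerConst (SOSDual.decPoly (boxN R) (CsoA.getD MoA [])) + (μoA 0 + μoA 1) * ((7 / 8 : ℚ) / 2 - νoA))
    {sloA : ℚ} (hsloA : sloA = (μoA 0 + μoA 1) / 2)
    (THoB : Terms (Orb (Fin (boxN R))))
    (hHoB : termOp (boxD R) THoB = (hubbardTTPrimeFermionInteraction 1 (((-3 / 10 : ℚ)) : ℝ) (((29 / 5 : ℚ)) : ℝ)).localHamiltonian (boxW R))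
    (TEoB : Terms (Orb (Fin (boxN R))))
    (hEoB : termOp (boxD R) TEoB =
      fermionEmbed (PolySite.incl (thicken01_subset_boxW (le_trans (by norm_num) h7R)))
        ((hubbardTTPrimeFermionInteraction 1 (((-3 / 10 : ℚ)) : ℝ) (((29 / 5 : ℚ)) : ℝ)).meanEnergyObs 1))
    (TXoB : Terms (Orb (Fin (boxN R))))
    (hXoB : termOp (boxD R) TXoB = fermionEmbed (PolySite.incl (box_subset_boxW h7R)) (-oddMomentObsTT (-3 / 10) (29 / 5) 0))
    (μoB : Fin 2 → ℚ) (νoB κoB capoB κoB' floB : ℚ) (KoB : ℕ) (blocksoB : List (List (List ℤ × Terms (Orb (Fin (boxN R))))))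
    (CWoB : Terms (Orb (Fin (boxN R)))) (hcwoB : ∀ wc ∈ CWoB, chargeW wc.1 ≠ 0 ∨ spinChargeW (fun a => (ofLex a).2) wc.1 ≠ 0)
    (AVoB : List (Terms (Orb (Fin (boxN R)))))
    (nsoB : List ℕ) (MoB : ℕ) (CsoB : List SOSDual.EncPoly) (hC0oB : CsoB.getD 0 [] = []) (HsoB : List (List (QHint (boxN r))))
    (hchainoB : ChainQAOK (boxQuot r R vmax) Bkey MoB CsoB
      (groupSlices (residTGslicesNear TXoB μoB νoB (fun σ => orb (boxIx R 0) σ) κoB capoB κoB' floB TEoB (gramTBRowsHalf KoB blocksoB) THoB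
        (boxPush r R) EBo (autoMasks THoB (boxPush r R) EBo) (fun l : Fin 0 => l.elim0) (fun l : Fin 0 => l.elim0) CWoB AVoB) nsoB) HsoB)
    {βoB : ℚ}
    (hβoB : haveI := neZero_boxN R; βoB ≤ lowerConst (SOSDual.decPoly (boxN R) (CsoB.getD MoB [])) + (μoB 0 + μoB 1) * ((7 / 8 : ℚ) / 2 - νoB))
    {sloB : ℚ} (hsloB : sloB = (μoB 0 + μoB 1) / 2)
    -- ===== the `Oi` pair =====
    (EBi : List (Terms (Orb (Fin (boxN r)))))
    (THiA : Terms (Orb (Fin (boxN R))))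
    (hHiA : termOp (boxD R) THiA = (hubbardTTPrimeFermionInteraction 1 (((-3 / 10 : ℚ)) : ℝ) (((29 / 5 : ℚ)) : ℝ)).localHamiltonian (boxW R))
    (TEiA : Terms (Orb (Fin (boxN R))))
    (hEiA : termOp (boxD R) TEiA =
      fermionEmbed (PolySite.incl (thicken01_subset_boxW (le_trans (by norm_num) h7R)))
        ((hubbardTTPrimeFermionInteraction 1 (((-3 / 10 : ℚ)) : ℝ) (((29 / 5 : ℚ)) : ℝ)).meanEnergyObs 1))
    (TXiA : Terms (Orb (Fin (boxN R))))
    (hXiA : termOp (boxD R) TXiA = fermionEmbed (PolySite.incl (box_subset_boxW h7R)) (-oddMomentObsTT (-3 / 10) (29 / 5) 0))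
    (μiA : Fin 2 → ℚ) (νiA κiA capiA κiA' fliA : ℚ) (KiA : ℕ) (blocksiA : List (List (List ℤ × Terms (Orb (Fin (boxN R))))))
    (CWiA : Terms (Orb (Fin (boxN R)))) (hcwiA : ∀ wc ∈ CWiA, chargeW wc.1 ≠ 0 ∨ spinChargeW (fun a => (ofLex a).2) wc.1 ≠ 0)
    (AViA : List (Terms (Orb (Fin (boxN R)))))
    (nsiA : List ℕ) (MiA : ℕ) (CsiA : List SOSDual.EncPoly) (hC0iA : CsiA.getD 0 [] = []) (HsiA : List (List (QHint (boxN r))))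
    (hchainiA : ChainQAOK (boxQuot r R vmax) Bkey MiA CsiA
      (groupSlices (residTGslicesNear TXiA μiA νiA (fun σ => orb (boxIx R 0) σ) κiA capiA κiA' fliA TEiA (gramTBRowsHalf KiA blocksiA) THiA
        (boxPush r R) EBi (autoMasks THiA (boxPush r R) EBi) (fun l : Fin 0 => l.elim0) (fun l : Fin 0 => l.elim0) CWiA AViA) nsiA) HsiA)
    {βiA : ℚ}
    (hβiA : haveI := neZero_boxN R; βiA ≤ lowerConst (SOSDual.decPoly (boxN R) (CsiA.getD MiA [])) + (μiA 0 + μiA 1) * ((7 / 8 : ℚ) / 2 - νiA))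
    {sliA : ℚ} (hsliA : sliA = (μiA 0 + μiA 1) / 2)
    (THiB : Terms (Orb (Fin (boxN R))))
    (hHiB : termOp (boxD R) THiB = (hubbardTTPrimeFermionInteraction 1 (((-1 / 5 : ℚ)) : ℝ) (((29 / 5 : ℚ)) : ℝ)).localHamiltonian (boxW R))
    (TEiB : Terms (Orb (Fin (boxN R))))
    (hEiB : termOp (boxD R) TEiB =
      fermionEmbed (PolySite.incl (thicken01_subset_boxW (le_trans (by norm_num) h7R)))
        ((hubbardTTPrimeFermionInteraction 1 (((-1 / 5 : ℚ)) : ℝ) (((29 / 5 : ℚ)) : ℝ)).meanEnergyObs 1))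
    (TXiB : Terms (Orb (Fin (boxN R))))
    (hXiB : termOp (boxD R) TXiB = fermionEmbed (PolySite.incl (box_subset_boxW h7R)) (-oddMomentObsTT (-1 / 5) (29 / 5) 0))
    (μiB : Fin 2 → ℚ) (νiB κiB capiB κiB' fliB : ℚ) (KiB : ℕ) (blocksiB : List (List (List ℤ × Terms (Orb (Fin (boxN R))))))
    (CWiB : Terms (Orb (Fin (boxN R)))) (hcwiB : ∀ wc ∈ CWiB, chargeW wc.1 ≠ 0 ∨ spinChargeW (fun a => (ofLex a).2) wc.1 ≠ 0)
    (AViB : List (Terms (Orb (Fin (boxN R)))))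
    (nsiB : List ℕ) (MiB : ℕ) (CsiB : List SOSDual.EncPoly) (hC0iB : CsiB.getD 0 [] = []) (HsiB : List (List (QHint (boxN r))))
    (hchainiB : ChainQAOK (boxQuot r R vmax) Bkey MiB CsiB
      (groupSlices (residTGslicesNear TXiB μiB νiB (fun σ => orb (boxIx R 0) σ) κiB capiB κiB' fliB TEiB (gramTBRowsHalf KiB blocksiB) THiB
        (boxPush r R) EBi (autoMasks THiB (boxPush r R) EBi) (fun l : Fin 0 => l.elim0) (fun l : Fin 0 => l.elim0) CWiB AViB) nsiB) HsiB)
    {βiB : ℚ}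
    (hβiB : haveI := neZero_boxN R; βiB ≤ lowerConst (SOSDual.decPoly (boxN R) (CsiB.getD MiB [])) + (μiB 0 + μiB 1) * ((7 / 8 : ℚ) / 2 - νiB))
    {sliB : ℚ} (hsliB : sliB = (μiB 0 + μiB 1) / 2)
    -- ===== row data and DECIDABLE side conditions (FILE D verbatim) =====
    (Fo Lo Fi Li c : ℚ)
    (hκoA : 0 ≤ κoA) (hκoA' : 0 ≤ κoA') (hκoB : 0 ≤ κoB) (hκoB' : 0 ≤ κoB')
    (hκiA : 0 ≤ κiA) (hκiA' : 0 ≤ κiA') (hκiB : 0 ≤ κiB) (hκiB' : 0 ≤ κiB')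
    (hLo₁ : (16211390 / 10000000 : ℚ) * (27 / 148) * (κoA - κoA' - (κoB - κoB')) ≤ Lo)
    (hLo₂ : (16211390 / 10000000 : ℚ) * (27 / 148) * -(κoA - κoA' - (κoB - κoB')) ≤ Lo) (hLo0 : 0 < Lo)
    (hFo : Fo ≤ (βoA - κoA * ((-136960406889 / 200000000000 : ℚ) - capoA) - κoA' * (floA - (-3))) -
      (Lo - ((βoB - κoB * ((-136960406889 / 200000000000 : ℚ) - capoB) - κoB' * (floB - (-3))) - (βoA - κoA * ((-136960406889 / 200000000000 : ℚ) - capoA) - κoA' * (floA - (-3))))) ^ 2 / (4 * Lo))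
    (hLi₁ : (16211390 / 10000000 : ℚ) * (1 / 10) * (κiA - κiA' - (κiB - κiB')) ≤ Li)
    (hLi₂ : (16211390 / 10000000 : ℚ) * (1 / 10) * -(κiA - κiA' - (κiB - κiB')) ≤ Li) (hLi0 : 0 ≤ Li)
    (hLi : Li ≤ |(βiB - κiB * ((-2686934003 / 4000000000 : ℚ) - capiB) - κiB' * (fliB - (-3))) - (βiA - κiA * ((-2686934003 / 4000000000 : ℚ) - capiA) - κiA' * (fliA - (-3)))|)
    (hFi : Fi ≤ min (βiA - κiA * ((-2686934003 / 4000000000 : ℚ) - capiA) - κiA' * (fliA - (-3))) (βiB - κiB * ((-2686934003 / 4000000000 : ℚ) - capiB) - κiB' * (fliB - (-3))))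
    (hbar : c ≤ 4017332 / 10000000) (hkin : (4001658052 / 10000000000 : ℚ) ≤ c)
    (pPo : -Fo - sloA * (171 / 200 - 7 / 8) ≤ c ∧ -Fo - sloA * (179 / 200 - 7 / 8) ≤ c ∧
      -Fo - sloB * (171 / 200 - 7 / 8) ≤ c ∧ -Fo - sloB * (179 / 200 - 7 / 8) ≤ c)
    (pOi : -Fi - sliA * (171 / 200 - 7 / 8) ≤ c ∧ -Fi - sliA * (179 / 200 - 7 / 8) ≤ c ∧
      -Fi - sliB * (171 / 200 - 7 / 8) ≤ c ∧ -Fi - sliB * (179 / 200 - 7 / 8) ≤ c) :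
    La214M2c_StiffnessBoxCeiling := by
  -- cast literals
  have eU : (((29 / 5 : ℚ)) : ℝ) = 29 / 5 := by norm_num
  have eo : (((-(357 / 740) : ℚ)) : ℝ) = -(357 / 740) := by norm_num
  have em : (((-3 / 10 : ℚ)) : ℝ) = -3 / 10 := by norm_num
  have ei : (((-1 / 5 : ℚ)) : ℝ) = -1 / 5 := by norm_num
  -- (1) the `Po` box pair ⇒ the constant-objective pair row
  have pairPo := TPrimePinnedPairRowWN.of_quotAdjChainKernelCertsTBRowsHalfAuto_box r R vmax h7R hrR hvR (29 / 5) (by norm_num) (7 / 8)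
    (-(357 / 740)) (-3 / 10) Bkey (-oddMomentObsTT (-3 / 10) (29 / 5) 0) EBo
    THoA hHoA TEoA hEoA TXoA hXoA μoA νoA κoA capoA κoA' floA KoA blocksoA CWoA hcwoA AVoA nsoA MoA CsoA hC0oA HsoA hchainoA hβoA hsloA
    THoB hHoB TEoB hEoB TXoB hXoB μoB νoB κoB capoB κoB' floB KoB blocksoB CWoB hcwoB AVoB nsoB MoB CsoB hC0oB HsoB hchainoB hβoB hsloB
  rw [eU, eo, em] at pairPo
  -- (2) the `Oi` box pair ⇒ the objective-family pair row
  have hXiA' : termOp (boxD R) TXiA =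
      fermionEmbed (PolySite.incl (box_subset_boxW h7R)) ((fun s : ℝ => -oddMomentObsTT s (29 / 5) 0) (((-3 / 10 : ℚ)) : ℝ)) := by
    simp only [em]; exact hXiA
  have hXiB' : termOp (boxD R) TXiB =
      fermionEmbed (PolySite.incl (box_subset_boxW h7R)) ((fun s : ℝ => -oddMomentObsTT s (29 / 5) 0) (((-1 / 5 : ℚ)) : ℝ)) := by
    simp only [ei]; exact hXiB
  have pairOi := TPrimePinnedPairFamilyRowWN.of_quotAdjChainKernelCertsTBRowsHalfAuto_box r R vmax h7R hrR hvR (29 / 5) (by norm_num) (7 / 8)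
    (-3 / 10) (-1 / 5) Bkey (fun s : ℝ => -oddMomentObsTT s (29 / 5) 0) EBi
    THiA hHiA TEiA hEiA TXiA hXiA' μiA νiA κiA capiA κiA' fliA KiA blocksiA CWiA hcwiA AViA nsiA MiA CsiA hC0iA HsiA hchainiA hβiA hsliA
    THiB hHiB TEiB hEiB TXiB hXiB' μiB νiB κiB capiB κiB' fliB KiB blocksiB CWiB hcwiB AViB nsiB MiB CsiB hC0iB HsiB hchainiB hβiB hsliB
  rw [eU, em, ei] at pairOi
  -- (3) the shape-level closer (p674101)
  exact La214M2c_StiffnessBoxCeiling_of_pairRows pairPo pairOi Fo Lo Fi Li c hκoA hκoA' hκoB hκoB' hκiA hκiA' hκiB hκiB' hLo₁ hLo₂ hLo0 hFo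
    hLi₁ hLi₂ hLi0 hLi hFi hbar hkin pPo pOi

end M2cRowsHalfCloser

end Summit.Ventures.CertifiedManyBodySolver.Downfold

end
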